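import Mathlib
import Literature.AlgebraicGeometry.Resolution.CobordantGame
import Literature.AlgebraicGeometry.Resolution.CobordantChartCoefficients
import Literature.AlgebraicGeometry.Resolution.FormalCoordinateChange
import Summits.ResolutionOfSingularities.ResolutionOfSingularities.Theorems.WeightedInvariantLocalWeightedDropNonSquareQuadricExit
import Summits.ResolutionOfSingularities.ResolutionOfSingularities.Theorems.WeightedInvariantLocalWeightedDropTerminalDoublePointsDimSteps

/-!
# `WeightedInvariant.LocalWeightedDrop`: a W4|₄ specimen with a JUMPING exceptional point — `y² + x₀x₁x₂(x₀+x₁+x₂)` in characteristic 2 is won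

Crux item stmt-ResolutionOfSingularities-8899 `LocalWeightedDrop`, skeleton v31, residual stub W4|₄ `stub_wildWideApexFourStartsWon` (`d = 2`:
char-2 threefold double points).  [OURS · L1 W4.3, chain w43, stub worker 4 (gen 4): a CALIBRATION of the `d = 2` layer (memo
`L/res-L1-w43-stub-4/W4-D2-LAYER.md` §3 (a)); NOT a statement of any manuscript.]

The germ `f = y² + x₀x₁x₂(x₀+x₁+x₂) ∈ k⟦x₀,x₁,x₂,y⟧` (`k = k̄`, characteristic `2`) satisfies the hypotheses of W4|₄ at `d = 2` (tangent quadric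
`y²`), is NOT terminal (`A₀` = four planes) and NOT semi-quasihomogeneous (even degree; the cone of `y² + F`, `F = x₀x₁x₂(x₀+x₁+x₂)`, is singular
along lines).  It is WON by the move «weights `(1,1,1,2)`, no coordinate change»: the saturated successor at the exceptional point `(c, γ)` is
`Q = (γ + Y)² + F(c + x')` (`f` is `(1,1,1,2)`-homogeneous of weight `4`), and
* if `c = 0` then `γ ≠ 0` and `Q(0) = γ² ≠ 0` — not singular;
* if `c_l ≠ 0` for some `l`, the CROSS coefficient of `Q` at the two other old slots is `c_l(c_l + 2(…)) = c_l² ≠ 0`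
  (`coeff_cross_fourLinFactors`), so `Q` — singular or not, in particular at the JUMPING point `c = (1,1,1)`, `γ = 1`, where `∇F(c) = 0` but
  `F(c) ≠ 0` — is won by the non-square-quadric exit in FIVE variables (`won_five_of_crossCoeff_ne_zero`, which rests on the now
  unconditional N = 3 layer `surfaceGermsWon`).
-/

set_option linter.dupNamespace false -- mandated namespace of this single-conjunct summit

namespace Summit.ResolutionOfSingularities.ResolutionOfSingularities.Theorems

open Literature.AlgebraicGeometry.Resolution
open Literature.AlgebraicGeometry.Resolution.CobordantGame

namespace ArrangementDoublePoint

open MvPowerSeries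

variable {k : Type} [Field k] {N : ℕ}

/-! ### Low coefficients of products with a variable or a constant -/

/-- `[x^e] (x_i · φ) = [x^{e - e_i}] φ` when `e_i ≤ e`. -/
theorem coeff_X_mul_of_le {e : Fin N →₀ ℕ} (i : Fin N) (h : Finsupp.single i 1 ≤ e) (φ : MvPowerSeries (Fin N) k) :
    coeff e (X i * φ) = coeff (e - Finsupp.single i 1) φ := by
  classical
  rw [X_def, coeff_monomial_mul, if_pos h, one_mul]

/-- `[x^e] (x_i · φ) = 0` when `e_i = 0`. -/
theorem coeff_X_mul_of_apply_eq_zero {e : Fin N →₀ ℕ} (i : Fin N) (h : e i = 0) (φ : MvPowerSeries (Fin N) k) :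
    coeff e (X i * φ) = 0 := by
  classical
  rw [X_def, coeff_monomial_mul, if_neg]
  intro hle
  have := hle i
  rw [Finsupp.single_eq_same, h] at this
  exact Nat.not_succ_le_zero 0 this

/-- The linear form `σ + x_i + x_j + x_l` has no degree-`2` coefficient at `e_a + e_b`. -/
theorem coeff_pair_linear (σ : k) (i j l a b : Fin N) :
    coeff (Finsupp.single a 1 + Finsupp.single b 1) (C σ + X i + X j + X l : MvPowerSeries (Fin N) k) = 0 := by
  have hne : ∀ m : Fin N, Finsupp.single a 1 + Finsupp.single b 1 ≠ Finsupp.single m 1 := by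
    intro m h
    have h2 := congrArg (fun e => Finsupp.degree e) h
    simp only [map_add, Finsupp.degree_single] at h2
    omega
  rw [map_add, map_add, map_add, coeff_C, if_neg (by
      intro h; have := congrArg (fun e => Finsupp.degree e) h; simp only [map_add, Finsupp.degree_single, map_zero] at this; omega),
    coeff_X, if_neg (hne i), coeff_X, if_neg (hne j), coeff_X, if_neg (hne l)]
  ring

/-- Linear coefficients of the linear form `σ + x_i + x_j + x_l` (distinct slots): `1` at `x_i`. -/
theorem coeff_single_linear_first (σ : k) {i j l : Fin N} (hij : i ≠ j) (hil : i ≠ l) :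
    coeff (Finsupp.single i 1) (C σ + X i + X j + X l : MvPowerSeries (Fin N) k) = 1 := by
  rw [map_add, map_add, map_add, coeff_C, if_neg (Finsupp.single_ne_zero.mpr one_ne_zero), coeff_X, if_pos rfl,
    coeff_X, if_neg (fun h => hij ((Finsupp.single_left_inj one_ne_zero).mp h)),
    coeff_X, if_neg (fun h => hil ((Finsupp.single_left_inj one_ne_zero).mp h))]
  ring

/-- **THE CROSS COEFFICIENT OF FOUR LINEAR FACTORS**: for distinct slots `i, j, l`,
`[x_i x_j] (a + x_i)(b + x_j)(c + x_l)(σ + x_i + x_j + x_l) = c · (a + b + σ)`. -/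
theorem coeff_cross_fourLinFactors (a b c σ : k) {i j l : Fin N} (hij : i ≠ j) (hil : i ≠ l) (hjl : j ≠ l) :
    coeff (Finsupp.single i 1 + Finsupp.single j 1)
        ((C a + X i) * (C b + X j) * (C c + X l) * (C σ + X i + X j + X l) : MvPowerSeries (Fin N) k) = c * (a + b + σ) := by
  classical
  set L : MvPowerSeries (Fin N) k := C σ + X i + X j + X l with hL
  set Nn : MvPowerSeries (Fin N) k := (C c + X l) * L with hNn
  -- the second pair of factors: constant `cσ`, linear coefficients `c` at `x_i`, `x_j`, nothing at `x_i x_j`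
  have hL0 : constantCoeff L = σ := by
    rw [hL, map_add, map_add, map_add, constantCoeff_C, constantCoeff_X, constantCoeff_X, constantCoeff_X]; ring
  have hN0 : constantCoeff Nn = c * σ := by
    rw [hNn, map_mul, map_add, constantCoeff_C, constantCoeff_X, add_zero, hL0]
  have hNi : coeff (Finsupp.single i 1) Nn = c := by
    rw [hNn, add_mul, map_add, coeff_C_mul, hL, coeff_single_linear_first σ hij hil,
      coeff_X_mul_of_apply_eq_zero l (by rw [Finsupp.single_apply, if_neg hil])]
    ring
  have hNj : coeff (Finsupp.single j 1) Nn = c := by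
    rw [hNn, add_mul, map_add, coeff_C_mul, hL, show (C σ + X i + X j + X l : MvPowerSeries (Fin N) k) = C σ + X j + X i + X l by ring,
      coeff_single_linear_first σ (Ne.symm hij) hjl,
      coeff_X_mul_of_apply_eq_zero l (by rw [Finsupp.single_apply, if_neg hjl])]
    ring
  have hNij : coeff (Finsupp.single i 1 + Finsupp.single j 1) Nn = 0 := by
    rw [hNn, add_mul, map_add, coeff_C_mul, hL, coeff_pair_linear,
      coeff_X_mul_of_apply_eq_zero l (by
        rw [Finsupp.add_apply, Finsupp.single_apply, Finsupp.single_apply, if_neg hil, if_neg hjl, add_zero])]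
    ring
  -- expand the first pair of factors and read off
  have hexp : ((C a + X i) * (C b + X j) * (C c + X l) * (C σ + X i + X j + X l) : MvPowerSeries (Fin N) k) =
      C (a * b) * Nn + C a * (X j * Nn) + C b * (X i * Nn) + X i * (X j * Nn) := by
    rw [hNn, hL, map_mul]; ring
  have hle_j : Finsupp.single j 1 ≤ Finsupp.single i 1 + Finsupp.single j 1 := le_add_self
  have hle_i : Finsupp.single i 1 ≤ Finsupp.single i 1 + Finsupp.single j 1 := le_self_add
  rw [hexp, map_add, map_add, map_add, coeff_C_mul, hNij, coeff_C_mul, coeff_X_mul_of_le j hle_j, add_tsub_cancel_right, hNi,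
    coeff_C_mul, coeff_X_mul_of_le i hle_i, add_tsub_cancel_left, hNj, coeff_X_mul_of_le i hle_i, add_tsub_cancel_left,
    coeff_X_mul_of_le j le_rfl, tsub_self, coeff_zero_eq_constantCoeff_apply, hN0]
  ring


/-- `(γ + Y)²` has no coefficient at a degree-`2` exponent avoiding `Y`. -/
theorem coeff_pair_C_add_X_sq_of_ne {M : ℕ} (γ : k) (u v : Fin (M + 1)) (hu : u ≠ Fin.last M) (hv : v ≠ Fin.last M) :
    coeff (Finsupp.single u 1 + Finsupp.single v 1) ((C γ + X (Fin.last M)) ^ 2 : MvPowerSeries (Fin (M + 1)) k) = 0 := by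
  have hlast : (Finsupp.single u 1 + Finsupp.single v 1 : Fin (M + 1) →₀ ℕ) (Fin.last M) = 0 := by
    rw [Finsupp.add_apply, Finsupp.single_apply, Finsupp.single_apply, if_neg hu, if_neg hv, add_zero]
  have h : ((C γ + X (Fin.last M)) ^ 2 : MvPowerSeries (Fin (M + 1)) k) =
      C (γ ^ 2) + C (2 * γ) * X (Fin.last M) + X (Fin.last M) ^ 2 := by
    rw [map_pow, map_mul, map_ofNat]; ring
  rw [h, map_add, map_add, coeff_C, if_neg (by
      intro h0; have := congrArg (fun e => e u) h0
      simp only [Finsupp.add_apply, Finsupp.single_eq_same, Finsupp.coe_zero, Pi.zero_apply] at this; omega),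
    coeff_C_mul, coeff_X, if_neg (by
      intro h1; have := congrArg (fun e => e (Fin.last M)) h1
      rw [hlast, Finsupp.single_eq_same] at this; exact zero_ne_one this),
    mul_zero, coeff_X_pow, if_neg (by
      intro h2; have := congrArg (fun e => e (Fin.last M)) h2
      rw [hlast, Finsupp.single_eq_same] at this; exact absurd this (by norm_num))]
  ring

/-- THE `(1,1,1,2)`-TRANSFORM OF THE SPECIMEN at the exceptional point `pt = (c, γ)`: `s⁴ · ((γ + Y)² + B♮)` with
`B = (c₀ + x₀')(c₁ + x₁')(c₂ + x₂')((c₀+c₁+c₂) + x₀'+x₁'+x₂')`. -/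
theorem transform_specimen (pt : Fin 4 → k) :
    subst (cruxChart k (Fin.insertNth (α := fun _ => ℕ) (Fin.last 3) 2 (fun _ => 1)) pt)
        (X (Fin.last 3) ^ 2 + rename (Fin.succAboveEmb (Fin.last 3))
          (X 0 * X 1 * X 2 * (X 0 + X 1 + X 2) : MvPowerSeries (Fin 3) k)) =
      X 0 ^ 4 * ((C (pt (Fin.last 3)) + X (Fin.last 4)) ^ 2 + rename (Fin.succAboveEmb (Fin.last 4))
        ((C (pt (Fin.castSucc 0)) + X (Fin.succ 0)) * (C (pt (Fin.castSucc 1)) + X (Fin.succ 1)) *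
          (C (pt (Fin.castSucc 2)) + X (Fin.succ 2)) *
          (C (pt (Fin.castSucc 0) + pt (Fin.castSucc 1) + pt (Fin.castSucc 2)) + X (Fin.succ 0) + X (Fin.succ 1) + X (Fin.succ 2)) :
          MvPowerSeries (Fin 4) k)) := by
  set Wt : Fin 4 → ℕ := Fin.insertNth (α := fun _ => ℕ) (Fin.last 3) 2 (fun _ => 1) with hWt
  have hs := hasSubst_of_constantCoeff_zero (constantCoeff_cruxChart (k := k) Wt pt)
  have hs' := hasSubst_of_constantCoeff_zero (constantCoeff_cruxChart (k := k) (fun _ : Fin 3 => (1 : ℕ))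
    (fun i => pt ((Fin.last 3).succAbove i)))
  have hlast : cruxChart k Wt pt (Fin.last 3) = X 0 ^ 2 * (C (pt (Fin.last 3)) + X (Fin.last 4)) := by
    rw [MultiplicityLift.cruxChart_last hWt pt, if_pos two_pos]
  have hslot : ∀ i : Fin 3, cruxChart k Wt pt (Fin.castSucc i) =
      X 0 * (C (pt (Fin.castSucc i)) + X (Fin.castSucc i.succ)) := by
    intro i
    rw [← Fin.succAbove_last, MultiplicityLift.cruxChart_succAbove hWt pt i]
    unfold cruxChart
    rw [if_pos one_pos, pow_one, map_mul, map_add, rename_X, rename_C, rename_X]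
    simp only [Fin.coe_succAboveEmb, Fin.succAbove_last, Fin.castSucc_zero]
  rw [← coe_substAlgHom hs]
  simp only [map_add, map_pow, map_mul, coe_substAlgHom, subst_X hs, rename_X, rename_C, Fin.coe_succAboveEmb,
    Fin.succAbove_last, hlast, hslot]
  ring

/-- **THE SPECIMEN `y² + x₀x₁x₂(x₀+x₁+x₂)` IS WON** (`k` algebraically closed of characteristic `2`): a non-terminal, non-semi-quasihomogeneous
member of W4|₄ ∩ {d = 2} with a JUMPING exceptional point, won in the kernel by the move `(1,1,1,2)` followed by the non-square-quadric exit
in five variables (which rests on `surfaceGermsWon`). [OURS · L1 W4.3 · calibration of the `d = 2` layer] -/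
theorem arrangementDoublePoint_won (k : Type) [Field k] [CharP k 2] [IsAlgClosed k] :
    CobordantGame.Won k 4 (X (Fin.last 3) ^ 2 + rename (Fin.succAboveEmb (Fin.last 3))
      (X 0 * X 1 * X 2 * (X 0 + X 1 + X 2) : MvPowerSeries (Fin 3) k)) := by
  classical
  set Wt : Fin 4 → ℕ := Fin.insertNth (α := fun _ => ℕ) (Fin.last 3) 2 (fun _ => 1) with hWtdef
  set P : MvPowerSeries (Fin 4) k := X (Fin.last 3) ^ 2 + rename (Fin.succAboveEmb (Fin.last 3))
    (X 0 * X 1 * X 2 * (X 0 + X 1 + X 2) : MvPowerSeries (Fin 3) k) with hP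
  have hWtlast : Wt (Fin.last 3) = 2 := by rw [hWtdef, Fin.insertNth_apply_same]
  have hWtcast : ∀ i, Wt (Fin.castSucc i) = 1 := fun i => by rw [hWtdef, ← Fin.succAbove_last, Fin.insertNth_apply_succAbove]
  have hmove : IsMove k (X : Fin 4 → MvPowerSeries (Fin 4) k) Wt := by
    refine ⟨fun l => constantCoeff_X l, ?_, ⟨Fin.last 3, by rw [hWtlast]; exact two_pos⟩⟩
    rw [← FormalCoordChange.linSubst_one, ConeDichotomy.linMat_linSubst, Matrix.det_one]
    exact isUnit_one
  refine Won.move X Wt hmove fun g hg => ?_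
  have hgS : CobordantGame.IsSingular k g := hg.isSingular
  obtain ⟨pt, a, ⟨l, hWl, hptl⟩, hfac, hndvd, hsing⟩ := hg
  have hself : subst (X : Fin 4 → MvPowerSeries (Fin 4) k) P = P := by
    rw [subst_self]; rfl
  rw [hself] at hfac
  set γ : k := pt (Fin.last 3) with hγ
  set c : Fin 3 → k := fun i => pt (Fin.castSucc i) with hc
  set B : MvPowerSeries (Fin 4) k := (C (c 0) + X (Fin.succ 0)) * (C (c 1) + X (Fin.succ 1)) * (C (c 2) + X (Fin.succ 2)) *
    (C (c 0 + c 1 + c 2) + X (Fin.succ 0) + X (Fin.succ 1) + X (Fin.succ 2)) with hB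
  set Q : MvPowerSeries (Fin 5) k := (C γ + X (Fin.last 4)) ^ 2 + rename (Fin.succAboveEmb (Fin.last 4)) B with hQ
  have hT : subst (cruxChart k Wt pt) P = X 0 ^ 4 * Q := by
    rw [hP, hWtdef, transform_specimen pt]
  -- `s ∤ Q`: the `Y²` coefficient is `1`
  have hndvd₀ : ¬ X 0 ∣ Q := by
    intro h
    have h1 := (X_dvd_iff.mp h) (Finsupp.single (Fin.last 4) 2) (by rw [Finsupp.single_apply, if_neg Fin.last_pos.ne'])
    rw [hQ, map_add, MultiplicityLift.coeff_single_rename_eq_zero B two_ne_zero, add_zero,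
      ← one_mul ((C γ + X (Fin.last 4)) ^ 2), ← map_one C, MultiplicityLift.coeff_single_C_mul_add_pow] at h1
    simp at h1
  rw [hT] at hfac
  obtain ⟨-, hgg⟩ := X_pow_mul_eq_X_pow_mul 0 hfac hndvd₀ hndvd
  subst hgg
  by_cases hc0 : ∀ i, c i = 0
  · -- `c = 0`: then `γ ≠ 0` and `Q(0) = γ²`
    exfalso
    have hγ0 : γ ≠ 0 := by
      rcases Fin.eq_castSucc_or_eq_last l with ⟨i, rfl⟩ | h
      · exact absurd (hc0 i) hptl
      · rw [hγ, ← h]; exact hptl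
    have h00 := hsing.1
    rw [hQ, map_add, TerminalDoublePointDim.constantCoeff_C_add_X_sq, constantCoeff_rename, hB] at h00
    simp only [map_mul, map_add, constantCoeff_C, constantCoeff_X, add_zero, hc0 0, zero_mul] at h00
    exact hγ0 (pow_eq_zero_iff two_ne_zero |>.mp h00)
  · -- some `c_{i₀} ≠ 0`: the cross coefficient at the two other old slots is `c_{i₀}²`
    push Not at hc0
    obtain ⟨i₀, hi₀⟩ := hc0
    have h2 : (2 : k) = 0 := CharTwo.two_eq_zero
    -- the cross coefficient of `Q` at old slots `u ≠ v` (both among `x₀', x₁', x₂'`) is that of `B`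
    have hcross : ∀ u v : Fin 3, coeff (Finsupp.single (Fin.succAboveEmb (Fin.last 4) u.succ) 1 +
        Finsupp.single (Fin.succAboveEmb (Fin.last 4) v.succ) 1) Q =
        coeff (Finsupp.single u.succ 1 + Finsupp.single v.succ 1) B := by
      intro u v
      rw [hQ, map_add, coeff_pair_C_add_X_sq_of_ne γ (Fin.succAboveEmb (Fin.last 4) u.succ) (Fin.succAboveEmb (Fin.last 4) v.succ)
          (by rw [Fin.coe_succAboveEmb]; exact Fin.succAbove_ne _ _) (by rw [Fin.coe_succAboveEmb]; exact Fin.succAbove_ne _ _),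
        zero_add, ← Finsupp.embDomain_single, ← Finsupp.embDomain_single, ← Finsupp.embDomain_add, coeff_embDomain_rename]
    have hne : ∀ u v : Fin 3, u ≠ v → (Fin.succAboveEmb (Fin.last 4)) u.succ ≠ (Fin.succAboveEmb (Fin.last 4)) v.succ :=
      fun u v huv h => huv (Fin.succ_injective _ ((Fin.succAboveEmb (Fin.last 4)).injective h))
    have h01 : (Fin.succ (0 : Fin 3) : Fin 4) ≠ Fin.succ 1 := by decide
    have h02 : (Fin.succ (0 : Fin 3) : Fin 4) ≠ Fin.succ 2 := by decide
    have h12 : (Fin.succ (1 : Fin 3) : Fin 4) ≠ Fin.succ 2 := by decide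
    fin_cases i₀
    · -- `c₀ ≠ 0`: pair `(x₁', x₂')`
      refine won_five_of_crossCoeff_ne_zero _ hgS (hne 1 2 (by decide)) ?_
      rw [hcross, hB, show ((C (c 0) + X (Fin.succ 0)) * (C (c 1) + X (Fin.succ 1)) * (C (c 2) + X (Fin.succ 2)) *
          (C (c 0 + c 1 + c 2) + X (Fin.succ 0) + X (Fin.succ 1) + X (Fin.succ 2)) : MvPowerSeries (Fin 4) k) =
          (C (c 1) + X (Fin.succ 1)) * (C (c 2) + X (Fin.succ 2)) * (C (c 0) + X (Fin.succ 0)) *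
          (C (c 0 + c 1 + c 2) + X (Fin.succ 1) + X (Fin.succ 2) + X (Fin.succ 0)) by ring,
        coeff_cross_fourLinFactors _ _ _ _ h12 (Ne.symm h01) (Ne.symm h02)]
      have : c 0 * (c 1 + c 2 + (c 0 + c 1 + c 2)) = c 0 ^ 2 := by linear_combination (c 0 * (c 1 + c 2)) * h2
      rw [this]
      exact pow_ne_zero 2 hi₀
    · -- `c₁ ≠ 0`: pair `(x₀', x₂')`
      refine won_five_of_crossCoeff_ne_zero _ hgS (hne 0 2 (by decide)) ?_
      rw [hcross, hB, show ((C (c 0) + X (Fin.succ 0)) * (C (c 1) + X (Fin.succ 1)) * (C (c 2) + X (Fin.succ 2)) *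
          (C (c 0 + c 1 + c 2) + X (Fin.succ 0) + X (Fin.succ 1) + X (Fin.succ 2)) : MvPowerSeries (Fin 4) k) =
          (C (c 0) + X (Fin.succ 0)) * (C (c 2) + X (Fin.succ 2)) * (C (c 1) + X (Fin.succ 1)) *
          (C (c 0 + c 1 + c 2) + X (Fin.succ 0) + X (Fin.succ 2) + X (Fin.succ 1)) by ring,
        coeff_cross_fourLinFactors _ _ _ _ h02 h01 (Ne.symm h12)]
      have : c 1 * (c 0 + c 2 + (c 0 + c 1 + c 2)) = c 1 ^ 2 := by linear_combination (c 1 * (c 0 + c 2)) * h2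
      rw [this]
      exact pow_ne_zero 2 hi₀
    · -- `c₂ ≠ 0`: pair `(x₀', x₁')`
      refine won_five_of_crossCoeff_ne_zero _ hgS (hne 0 1 (by decide)) ?_
      rw [hcross, hB, coeff_cross_fourLinFactors _ _ _ _ h01 h02 h12]
      have : c 2 * (c 0 + c 1 + (c 0 + c 1 + c 2)) = c 2 ^ 2 := by linear_combination (c 2 * (c 0 + c 1)) * h2
      rw [this]
      exact pow_ne_zero 2 hi₀

end ArrangementDoublePoint

end Summit.ResolutionOfSingularities.ResolutionOfSingularities.Theorems
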